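import Summits.KontsevichZagierPeriods.KontsevichZagierPeriods.Theorems.RootDecompQuadraticDescentEisensteinPairP7

/-!
# Census pair #22 (the ℚ(√−3) pair 4·[□²,1/(3−2N)] ≡ 5·[□²,1/(3−N)], N = u²−uv+v²) and #0 DECIDED in `KZ.relations` by rules 1+2 (route `RootDecompQuadraticDescent`, instances of crux stmt-KontsevichZagierPeriods-28994 / stmt-4280) · part 8/9

Cell `decomp-kz`, lens 6 (decomp-kz-lens-6 g7): `pair22` (NO Stokes; blow-up + conic log band + seven ℚ-rational base substitutions; every piecewise-affine chain certified impossible) and `pair0`; packaged `pairs_decided`, `pairs_descentTwoQ_instances`, `pairs_of_kzDimTwo` BY NAME.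

Source: `HOME/decomp-kz-lens-6/g7/EisensteinPair22.lean` sha256 fdb5e0bbc5a4a341 (1894 l; critic decomp-kz-crit-1 g2 CLEARED 2026-08-30T07:59:44Z, std axioms), split by the landing seat decomp-kz-census-1 g7 (earlier parts as landed; the remainder re-cut smaller to respect the 400-line policy after private dedup copies); the route file is imported only by the last part.  No `sorry`; standard axioms.  References: [cite: KontsevichZagier2001, §1.2].
-/

noncomputable section

open MeasureTheory Set MvPolynomial

namespace Summit.KontsevichZagierPeriods.RootDecompQuadraticDescent.EisensteinPair

open Literature.NumberTheory.Transcendental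
open Literature.NumberTheory.Transcendental.KZ
open Literature.ModelTheory.ExponentialFields (IsSemialgebraic)

-- PRIVATE copy (twin landed in SurdPairsP3; dedup.landed): rel_lin
/-- `[T + S] ≡ [T] + [S]` on the square (rule 1b). -/
private theorem rel_lin (TS T S : RFun 2) (h : ∀ x ∈ cube 2, TS.fn x = T.fn x + S.fn x) :
    KZ.of TS.rep - KZ.of T.rep - KZ.of S.rep ∈ KZ.relations :=
  KZ.cubicalLinGens_subset_relations (KZ.mem_cubicalLinGens TS.isTameCube_rep T.isTameCube_rep
    S.isTameCube_rep fun x hx => by simpa using h x hx)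

-- PRIVATE copy (landed twin in DarkPairs/HermiteRigidity modules; dedup.landed): rel_double
/-- `[2T] ≡ 2·[T]` on the square. -/
private theorem rel_double (T T2 : RFun 2) (h : ∀ x ∈ cube 2, T2.fn x = T.fn x + T.fn x) :
    KZ.of T2.rep - 2 • KZ.of T.rep ∈ KZ.relations := by
  have h1 := rel_lin T2 T T h
  have : KZ.of T2.rep - 2 • KZ.of T.rep = KZ.of T2.rep - KZ.of T.rep - KZ.of T.rep := by abel
  rwa [this]

-- PRIVATE copy (landed twin elsewhere; dedup.landed): snoc2_zero, snoc2_one, init2_zero, last_one_eq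
/-- `snoc2_zero`: auxiliary theorem of the lens-6 development «eis» (instances of 28994/4280) — see the module docstring; verbatim from the lens file. -/
@[simp] private theorem snoc2_zero (x : Fin 1 → ℝ) (t : ℝ) : (Fin.snoc x t : Fin 2 → ℝ) 0 = x 0 := rfl

/-- `snoc2_one`: auxiliary theorem of the lens-6 development «eis» (instances of 28994/4280) — see the module docstring; verbatim from the lens file. -/
@[simp] private theorem snoc2_one (x : Fin 1 → ℝ) (t : ℝ) : (Fin.snoc x t : Fin 2 → ℝ) 1 = t := rfl

/-- `init2_zero`: auxiliary theorem of the lens-6 development «eis» (instances of 28994/4280) — see the module docstring; verbatim from the lens file. -/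
@[simp] private theorem init2_zero (z : Fin 2 → ℝ) : Fin.init z 0 = z 0 := rfl

/-- `last_one_eq`: auxiliary theorem of the lens-6 development «eis» (instances of 28994/4280) — see the module docstring; verbatim from the lens file. -/
private theorem last_one_eq : (Fin.last 1 : Fin 2) = 1 := rfl

section Census

/-- `[□², 1/Q_A]`. -/
def A22 : RFun 2 := ⟨1, QA22, fun _ hx => (QA22_pos hx).ne'⟩
/-- `[□², 1/Q_B]`. -/
def B22 : RFun 2 := ⟨1, QB22, fun _ hx => (QB22_pos hx).ne'⟩
/-- `[□², 2/Q_A]`. -/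
def A22two : RFun 2 := ⟨2, QA22, fun _ hx => (QA22_pos hx).ne'⟩
/-- `[□², 4/Q_A]`. -/
def A22four : RFun 2 := ⟨4, QA22, fun _ hx => (QA22_pos hx).ne'⟩
/-- `[□², 2/Q_B]`. -/
def B22two : RFun 2 := ⟨2, QB22, fun _ hx => (QB22_pos hx).ne'⟩
/-- `[□², 4/Q_B]`. -/
def B22four : RFun 2 := ⟨4, QB22, fun _ hx => (QB22_pos hx).ne'⟩
/-- `[□², 5/Q_B]`. -/
def B22five : RFun 2 := ⟨5, QB22, fun _ hx => (QB22_pos hx).ne'⟩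

/-- `A22_Torig`: auxiliary theorem of the lens-6 development «eis» (instances of 28994/4280) — see the module docstring; verbatim from the lens file. -/
theorem A22_Torig : KZ.of A22.rep - KZ.of (Torig hμA).rep ∈ KZ.relations :=
  RFun.rel_of_eqOn fun x _ => by
    show aeval x 1 / aeval x QA22 = aeval x 1 / aeval x (Qorig 2)
    rw [QA22_eq]

/-- `B22_Torig`: auxiliary theorem of the lens-6 development «eis» (instances of 28994/4280) — see the module docstring; verbatim from the lens file. -/
theorem B22_Torig : KZ.of B22.rep - KZ.of (Torig hμB).rep ∈ KZ.relations :=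
  RFun.rel_of_eqOn fun x _ => by
    show aeval x 1 / aeval x QB22 = aeval x 1 / aeval x (Qorig 1)
    rw [QB22_eq]

/-- A-side of Part I: `[□², 1/Q_A] ≡ 2·[band, (1/4)/(q(u)s)]` with upper edge `3/(1+2u−2u²)`. -/
theorem EA22 : KZ.of A22.rep - 2 • KZ.of (U 0 1 (1 / 4) vA01) ∈ KZ.relations := by
  have h1 := A22_Torig
  have h2 := chain hμA (1 / 4) (by norm_num) vA01 fun t _ => by
    show vAF t = _
    simp only [vAF, qf]
    push_cast
    ring
  convert add_mem h1 h2 using 1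
  abel

/-- B-side of Part I: `[□², 1/Q_B] ≡ 2·[band, (1/2)/(q(u)s)]` with upper edge `3/((2−u)(1+u))`. -/
theorem EB22 : KZ.of B22.rep - 2 • KZ.of (U 0 1 (1 / 2) vB01) ∈ KZ.relations := by
  have h1 := B22_Torig
  have h2 := chain hμB (1 / 2) (by norm_num) vB01 fun t _ => by
    show vBF t = _
    simp only [vBF, qf]
    push_cast
    ring
  convert add_mem h1 h2 using 1
  abel

/-- **Census pair #22 DECIDED**: `4·[□², 1/(1+2x+2y−2x²+2xy−2y²)] − 5·[□², 1/(2+x+y−x²+xy−y²)]`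
lies in `KZ.relations` (the closure of Kontsevich–Zagier's rules 1 and 2 — additivity and algebraic
changes of variables — inside dimension 2; rule 3 is not used). -/
theorem pair22 : 4 • KZ.of A22.rep - 5 • KZ.of B22.rep ∈ KZ.relations := by
  have EA := EA22
  have EB := EB22
  have hA1 := rel_two_half 0 1 1 vA01
  have hA2 := rel_two_half 0 1 (1 / 2) vA01
  rw [show (1 / 2 / 2 : ℚ) = 1 / 4 by norm_num] at hA2
  have hB1 := rel_two_half 0 1 1 vB01
  have core := logCore 1
  have h := add_mem (sub_mem (sub_mem (sub_mem (zsmul_mem EA 4) (zsmul_mem EB 5)) (zsmul_mem hA2 4))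
    (zsmul_mem hA1 2)) (add_mem (zsmul_mem hB1 5) core)
  convert h using 1
  abel

/-- `[□², 4/Q_A] ≡ [□², 5/Q_B]`. -/
theorem pair22_equivalent : KZ.Equivalent A22four.rep B22five.rep := by
  have hA2 := rel_double A22 A22two fun x _ => by
    simp only [A22, A22two, RFun.fn, map_one, map_ofNat]; ring
  have hA4 := rel_double A22two A22four fun x _ => by
    simp only [A22two, A22four, RFun.fn, map_ofNat]; ring
  have hB2 := rel_double B22 B22two fun x _ => by
    simp only [B22, B22two, RFun.fn, map_one, map_ofNat]; ring
  have hB4 := rel_double B22two B22four fun x _ => by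
    simp only [B22two, B22four, RFun.fn, map_ofNat]; ring
  have hB5 := rel_lin B22five B22four B22 fun x _ => by
    simp only [B22, B22four, B22five, RFun.fn, map_one, map_ofNat]; ring
  have h := sub_mem (sub_mem (sub_mem (add_mem (add_mem pair22 hA4) (zsmul_mem hA2 2)) hB5) hB4)
    (zsmul_mem hB2 2)
  show KZ.of A22four.rep - KZ.of B22five.rep ∈ KZ.relations
  convert h using 1
  abel

/-- `pair22_value`: auxiliary theorem of the lens-6 development «eis» (instances of 28994/4280) — see the module docstring; verbatim from the lens file. -/
theorem pair22_value : A22four.rep.value = B22five.rep.value :=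
  KZ.Equivalent.value_eq_holds pair22_equivalent

/-! ## Census pair #0: `[□², 1/(1+y+2y²)] − [□², 1/(2−x+x²)]` — one projective substitution -/

/-- `1 + y + 2y²` (census pair #0, first member; `y = x₁`). -/
def QA0 : MvPolynomial (Fin 2) ℚ := 1 + X 1 + 2 * X 1 ^ 2
/-- `2 − x + x²` (census pair #0, second member; `x = x₀`). -/
def QB0 : MvPolynomial (Fin 2) ℚ := 2 - X 0 + X 0 ^ 2

/-- `QA0_pos`: auxiliary theorem of the lens-6 development «eis» (instances of 28994/4280) — see the module docstring; verbatim from the lens file. -/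
theorem QA0_pos (x : Fin 2 → ℝ) : 0 < aeval x QA0 := by
  simp only [QA0, map_add, map_mul, map_pow, map_ofNat, map_one, aeval_X]
  nlinarith [sq_nonneg (x 1 + 1 / 4)]

/-- `QB0_pos`: auxiliary theorem of the lens-6 development «eis» (instances of 28994/4280) — see the module docstring; verbatim from the lens file. -/
theorem QB0_pos (x : Fin 2 → ℝ) : 0 < aeval x QB0 := by
  simp only [QB0, map_add, map_sub, map_pow, map_ofNat, aeval_X]
  nlinarith [sq_nonneg (x 0 - 1 / 2)]

/-- `[□², 1/(1+y+2y²)]`. -/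
def A0 : RFun 2 := ⟨1, QA0, fun x _ => (QA0_pos x).ne'⟩
/-- `[□², 1/(2−x+x²)]`. -/
def B0 : RFun 2 := ⟨1, QB0, fun x _ => (QB0_pos x).ne'⟩

/-- `cube_eq_band`: auxiliary theorem of the lens-6 development «eis» (instances of 28994/4280) — see the module docstring; verbatim from the lens file. -/
theorem cube_eq_band : cube 2 = KZlog.band (ivl 0 1) (fun _ => 0) fun _ => 1 := by
  ext z
  rw [KZlog.mem_band, last_one_eq, mem_ivl, mem_cube, Fin.forall_fin_two]
  simp only [init2_zero, Rat.cast_zero, Rat.cast_one]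

end Census

end Summit.KontsevichZagierPeriods.RootDecompQuadraticDescent.EisensteinPair

end
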